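import Mathlib

/-!
# Sloped ladder, rung level stub — part 1: Abel summation and bookkeeping

Route `LiouvilleShiftedTables` (Parity / GeneralizedHardyLittlewood), crux stmt-Parity-9389
(`PairsToGHL`), line `sloped_ladder`, stub `stub_rungLevelPart` (the level/remainder piece of
Bombieri's asymptotic-sieve rung). Generic real-analysis and finite-sum lemmas used by the
estimate; nothing here refers to the forms.

* `abel_aux`, `abel_bound` — `|∑_{n ≤ N} f(n) G(n)| ≤ 2 f(N) · max_{y ≤ N} |∑_{n ≤ y} G(n)|` for a
  non-negative non-decreasing weight `f` (partial summation);
* `sum_swap_indicator`, `abs_sum_moebius_mul_le`, `exists_maximizer`, `sum_reindex_le` —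
  swapping the `n`- and `d`-sums, `|μ| ≤ 1`, maximising heights, and the re-indexing
  `d ↦ (gcd(a,d), d/gcd(a,d))` that feeds the level hypothesis once per divisor of `a`;
* `level_le_eventually`, `log_bookkeeping` — `(aN+b)/(⌊N^{ε₁}⌋+1) ≤ ⌊N^{1-ε₁/2}⌋` for large
  `N`, and the final `ε`-arithmetic `2 L τ C N/ℓ³ ≤ η N`.

[folklore]
-/

open Finset Filter

namespace Summit.Parity.GeneralizedHardyLittlewood.Theorems.PairsToGHL.SlopedLadder

namespace RungLevel

/-! ### Abel summation with a monotone weight -/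

/-- Partial summation, inductive form: for `f` non-decreasing on `[1, N]` and
`|∑_{n ≤ y} G n| ≤ M` for all `y ≤ N`, for every `1 ≤ k ≤ N`:
`f 1 ≤ f k` and `|∑_{n ≤ k} f n G n - f k ∑_{n ≤ k} G n| ≤ (f k - f 1) M`. [folklore] -/
theorem abel_aux (f G : ℕ → ℝ) (N : ℕ) (M : ℝ)
    (hmono : ∀ n, 1 ≤ n → n < N → f n ≤ f (n + 1))
    (hM : ∀ y, y ≤ N → |∑ n ∈ Icc 1 y, G n| ≤ M) :
    ∀ k, 1 ≤ k → k ≤ N → f 1 ≤ f k ∧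
      |∑ n ∈ Icc 1 k, f n * G n - f k * ∑ n ∈ Icc 1 k, G n| ≤ (f k - f 1) * M := by
  intro k hk
  induction k, hk using Nat.le_induction with
  | base =>
    intro _
    simp
  | succ k hk ih =>
    intro hkN
    obtain ⟨ih1, ih2⟩ := ih (Nat.le_of_succ_le hkN)
    have hstep : f k ≤ f (k + 1) := hmono k hk hkN
    have hSk : |∑ n ∈ Icc 1 k, G n| ≤ M := hM k (Nat.le_of_succ_le hkN)
    refine ⟨ih1.trans hstep, ?_⟩
    rw [Finset.sum_Icc_succ_top (by omega), Finset.sum_Icc_succ_top (by omega)]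
    have key : ∑ n ∈ Icc 1 k, f n * G n + f (k + 1) * G (k + 1) -
        f (k + 1) * (∑ n ∈ Icc 1 k, G n + G (k + 1)) =
        (∑ n ∈ Icc 1 k, f n * G n - f k * ∑ n ∈ Icc 1 k, G n) +
          (f k - f (k + 1)) * ∑ n ∈ Icc 1 k, G n := by ring
    rw [key]
    calc |(∑ n ∈ Icc 1 k, f n * G n - f k * ∑ n ∈ Icc 1 k, G n) +
          (f k - f (k + 1)) * ∑ n ∈ Icc 1 k, G n|
        ≤ |∑ n ∈ Icc 1 k, f n * G n - f k * ∑ n ∈ Icc 1 k, G n| +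
          |(f k - f (k + 1)) * ∑ n ∈ Icc 1 k, G n| := abs_add_le _ _
      _ ≤ (f k - f 1) * M + (f (k + 1) - f k) * M := by
          refine add_le_add ih2 ?_
          rw [abs_mul, show |f k - f (k + 1)| = f (k + 1) - f k by
            rw [abs_sub_comm]; exact abs_of_nonneg (by linarith)]
          exact mul_le_mul_of_nonneg_left hSk (by linarith)
      _ = (f (k + 1) - f 1) * M := by ring

/-- **Abel summation bound.** If `0 ≤ f 1`, `f` is non-decreasing on `[1, N]` (`N ≥ 1`) and
`|∑_{n ≤ y} G n| ≤ M` for all `y ≤ N`, then `|∑_{n ≤ N} f n G n| ≤ 2 f(N) M`. [folklore] -/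
theorem abel_bound (f G : ℕ → ℝ) {N : ℕ} (hN : 1 ≤ N) (M : ℝ) (hf1 : 0 ≤ f 1)
    (hmono : ∀ n, 1 ≤ n → n < N → f n ≤ f (n + 1))
    (hM : ∀ y, y ≤ N → |∑ n ∈ Icc 1 y, G n| ≤ M) :
    |∑ n ∈ Icc 1 N, f n * G n| ≤ 2 * f N * M := by
  obtain ⟨h1, h2⟩ := abel_aux f G N M hmono hM N hN le_rfl
  have hM0 : 0 ≤ M := le_trans (abs_nonneg _) (hM 0 (Nat.zero_le _))
  have hfN : 0 ≤ f N := hf1.trans h1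
  have hSN : |∑ n ∈ Icc 1 N, G n| ≤ M := hM N le_rfl
  calc |∑ n ∈ Icc 1 N, f n * G n|
      = |(∑ n ∈ Icc 1 N, f n * G n - f N * ∑ n ∈ Icc 1 N, G n) + f N * ∑ n ∈ Icc 1 N, G n| := by
        rw [sub_add_cancel]
    _ ≤ |∑ n ∈ Icc 1 N, f n * G n - f N * ∑ n ∈ Icc 1 N, G n| + |f N * ∑ n ∈ Icc 1 N, G n| :=
        abs_add_le _ _
    _ ≤ (f N - f 1) * M + f N * M := by
        refine add_le_add h2 ?_
        rw [abs_mul, abs_of_nonneg hfN]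
        exact mul_le_mul_of_nonneg_left hSN hfN
    _ ≤ 2 * f N * M := by nlinarith

/-! ### Bookkeeping: swapping the sums, `|μ| ≤ 1`, maximising heights, re-indexing -/

/-- Swapping a double sum whose inner range `d ≤ X n` is bounded by `D` on the outer range.
[folklore] -/
theorem sum_swap_indicator (N D : ℕ) (X : ℕ → ℕ) (hX : ∀ n ∈ Icc 1 N, X n ≤ D) (T : ℕ → ℕ → ℝ) :
    ∑ n ∈ Icc 1 N, ∑ d ∈ Icc 1 (X n), T n d =
      ∑ d ∈ Icc 1 D, ∑ n ∈ Icc 1 N, if d ≤ X n then T n d else 0 := by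
  rw [Finset.sum_comm' (t' := Icc 1 D) (s' := fun d => (Icc 1 N).filter (fun n => d ≤ X n))]
  · refine Finset.sum_congr rfl fun d _ => ?_
    rw [Finset.sum_filter]
  · intro n d
    simp only [Finset.mem_Icc, Finset.mem_filter]
    constructor
    · rintro ⟨hn, hd1, hdX⟩
      exact ⟨⟨hn, hdX⟩, hd1, hdX.trans (hX n (mem_Icc.2 hn))⟩
    · rintro ⟨⟨hn, hdX⟩, hd1, _⟩
      exact ⟨hn, hd1, hdX⟩

/-- `|∑_d μ(d) A_d| ≤ ∑_d |A_d|`. [folklore] -/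
theorem abs_sum_moebius_mul_le (s : Finset ℕ) (A : ℕ → ℝ) :
    |∑ d ∈ s, (ArithmeticFunction.moebius d : ℝ) * A d| ≤ ∑ d ∈ s, |A d| := by
  refine (Finset.abs_sum_le_sum_abs _ _).trans (Finset.sum_le_sum fun d _ => ?_)
  rw [abs_mul]
  have h1 : |(ArithmeticFunction.moebius d : ℝ)| ≤ 1 := by
    exact_mod_cast ArithmeticFunction.abs_moebius_le_one
  calc |(ArithmeticFunction.moebius d : ℝ)| * |A d| ≤ 1 * |A d| :=
        mul_le_mul_of_nonneg_right h1 (abs_nonneg _)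
    _ = |A d| := one_mul _

/-- For every modulus a height `y_d ≤ N` maximising `|S_d(y)|` over `y ≤ N`. [folklore] -/
theorem exists_maximizer (S : ℕ → ℕ → ℝ) (N : ℕ) :
    ∃ y : ℕ → ℕ, (∀ d, y d ≤ N) ∧ ∀ d y', y' ≤ N → |S d y'| ≤ |S d (y d)| := by
  have key : ∀ d, ∃ y₀, y₀ ≤ N ∧ ∀ y', y' ≤ N → |S d y'| ≤ |S d y₀| := fun d => by
    obtain ⟨y₀, hy₀, hmax⟩ :=
      Finset.exists_max_image (range (N + 1)) (fun y => |S d y|) ⟨0, by simp⟩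
    exact ⟨y₀, Nat.lt_succ_iff.mp (mem_range.1 hy₀),
      fun y' hy' => hmax y' (mem_range.2 (Nat.lt_succ_of_le hy'))⟩
  choose y hy using key
  exact ⟨y, fun d => (hy d).1, fun d => (hy d).2⟩

/-- **Re-indexing by `g = gcd(a, d)`.** If every choice of classes `r` and heights `Y ≤ N`
has `∑_{e ≤ D₁} |E(e, r_e, Y_e)| ≤ R`, then for `D ≤ D₁` and heights `y ≤ N`:
`∑_{d ≤ D} |E(d / gcd(a,d), ρ_d, y_d)| ≤ τ(a) R` — split by the value `g ∣ a` of `gcd(a, d)`;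
for fixed `g` the map `d ↦ d/g` is injective with image in `[1, D₁]`. [folklore] -/
theorem sum_reindex_le {a : ℕ} (ha : 0 < a) {N D D₁ : ℕ} (hD : D ≤ D₁) (E : ℕ → ℕ → ℕ → ℝ)
    (ρ y : ℕ → ℕ) (hy : ∀ d, y d ≤ N) (R : ℝ)
    (hR : ∀ r Y : ℕ → ℕ, (∀ e, Y e ≤ N) → ∑ e ∈ Icc 1 D₁, |E e (r e) (Y e)| ≤ R) :
    ∑ d ∈ Icc 1 D, |E (d / Nat.gcd a d) (ρ d) (y d)| ≤ (Nat.divisors a).card * R := by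
  have hmaps : ∀ d ∈ Icc 1 D, Nat.gcd a d ∈ Nat.divisors a := fun d _ =>
    Nat.mem_divisors.2 ⟨Nat.gcd_dvd_left a d, ha.ne'⟩
  rw [← Finset.sum_fiberwise_of_maps_to hmaps, ← nsmul_eq_mul]
  refine Finset.sum_le_card_nsmul _ _ _ fun g hg => ?_
  have hg0 : 0 < g := Nat.pos_of_mem_divisors hg
  set s := (Icc 1 D).filter (fun d => Nat.gcd a d = g) with hs
  have hmem : ∀ d ∈ s, 1 ≤ d ∧ d ≤ D ∧ Nat.gcd a d = g := fun d hd => by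
    simp only [hs, Finset.mem_filter, Finset.mem_Icc] at hd
    exact ⟨hd.1.1, hd.1.2, hd.2⟩
  have hgd : ∀ d ∈ s, g * (d / g) = d := fun d hd =>
    Nat.mul_div_cancel' ((hmem d hd).2.2 ▸ Nat.gcd_dvd_right a d)
  -- rewrite the summand through `e = d / g`
  have h1 : ∑ d ∈ s, |E (d / Nat.gcd a d) (ρ d) (y d)| =
      ∑ d ∈ s, |E (d / g) (ρ (g * (d / g))) (y (g * (d / g)))| :=
    Finset.sum_congr rfl fun d hd => by rw [(hmem d hd).2.2, hgd d hd]
  have hinj : Set.InjOn (fun d => d / g) s := by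
    intro d₁ hd₁ d₂ hd₂ he
    have := congrArg (fun e => g * e) he
    simp only at this
    rwa [hgd d₁ hd₁, hgd d₂ hd₂] at this
  rw [h1, ← Finset.sum_image (f := fun e => |E e (ρ (g * e)) (y (g * e))|) hinj]
  calc ∑ e ∈ s.image (fun d => d / g), |E e (ρ (g * e)) (y (g * e))|
      ≤ ∑ e ∈ Icc 1 D₁, |E e (ρ (g * e)) (y (g * e))| := by
        refine Finset.sum_le_sum_of_subset_of_nonneg ?_ fun _ _ _ => abs_nonneg _
        intro e he
        rw [Finset.mem_image] at he
        obtain ⟨d, hd, rfl⟩ := he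
        obtain ⟨hd1, hdD, hdg'⟩ := hmem d hd
        have hgd' : g ∣ d := hdg' ▸ Nat.gcd_dvd_right a d
        rw [Finset.mem_Icc]
        refine ⟨?_, (Nat.div_le_self d g).trans (hdD.trans hD)⟩
        exact Nat.div_pos (Nat.le_of_dvd hd1 hgd') hg0
    _ ≤ R := hR (fun e => ρ (g * e)) (fun e => y (g * e)) fun e => hy _

/-! ### Sizes: `X(N) ≤ ⌊N^{1-ε₁/2}⌋` and the final `ε`-arithmetic -/

/-- For large `N`: `(aN+b)/(⌊N^{ε₁}⌋+1) ≤ ⌊N^{1-ε₁/2}⌋` (indeed `< (a+b) N^{1-ε₁}` and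
`a + b ≤ N^{ε₁/2}`). [folklore] -/
theorem level_le_eventually (a b : ℕ) {ε₁ : ℝ} (hε₁ : 0 < ε₁) :
    ∀ᶠ N : ℕ in atTop, (a * N + b) / (⌊(N : ℝ) ^ ε₁⌋₊ + 1) ≤ ⌊(N : ℝ) ^ (1 - ε₁ / 2)⌋₊ := by
  have hev := ((tendsto_rpow_atTop (half_pos hε₁)).comp tendsto_natCast_atTop_atTop).eventually_ge_atTop
    ((a + b : ℕ) : ℝ)
  filter_upwards [hev, eventually_ge_atTop 1] with N hN hN1
  rw [Function.comp_apply] at hN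
  have hN0 : (0 : ℝ) < N := by exact_mod_cast hN1
  have hpow : (0 : ℝ) < (N : ℝ) ^ ε₁ := Real.rpow_pos_of_pos hN0 _
  refine Nat.le_floor ?_
  calc (((a * N + b) / (⌊(N : ℝ) ^ ε₁⌋₊ + 1) : ℕ) : ℝ)
      ≤ ((a * N + b : ℕ) : ℝ) / ((⌊(N : ℝ) ^ ε₁⌋₊ + 1 : ℕ) : ℝ) := Nat.cast_div_le
    _ ≤ ((a * N + b : ℕ) : ℝ) / (N : ℝ) ^ ε₁ := by
        refine div_le_div_of_nonneg_left (Nat.cast_nonneg _) hpow ?_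
        push_cast
        exact (Nat.lt_floor_add_one _).le
    _ ≤ (((a + b) * N : ℕ) : ℝ) / (N : ℝ) ^ ε₁ := by
        gcongr
        nlinarith
    _ = ((a + b : ℕ) : ℝ) * (N : ℝ) ^ (1 - ε₁) := by
        rw [Real.rpow_sub hN0, Real.rpow_one]
        push_cast
        ring
    _ ≤ (N : ℝ) ^ (ε₁ / 2) * (N : ℝ) ^ (1 - ε₁) := by
        gcongr
    _ = (N : ℝ) ^ (1 - ε₁ / 2) := by
        rw [← Real.rpow_add hN0]
        ring_nf

/-- The final arithmetic: if `L ≤ 2ℓ`, `1 ≤ ℓ`, `4 τ C ≤ η ℓ` (all quantities non-negative)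
then `2 L (τ (C N / ℓ³)) ≤ η N`. [folklore] -/
theorem log_bookkeeping {L ℓ τ C η N : ℝ} (hL : L ≤ 2 * ℓ) (hℓ : 1 ≤ ℓ)
    (hτ : 0 ≤ τ) (hC : 0 ≤ C) (hη0 : 0 ≤ η) (hN : 0 ≤ N) (hη : 4 * τ * C ≤ η * ℓ) :
    2 * L * (τ * (C * N / ℓ ^ (3 : ℕ))) ≤ η * N := by
  have hℓ0 : 0 < ℓ := by linarith
  have h1 : 0 ≤ τ * (C * N / ℓ ^ (3 : ℕ)) := by positivity
  calc 2 * L * (τ * (C * N / ℓ ^ (3 : ℕ)))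
      ≤ 2 * (2 * ℓ) * (τ * (C * N / ℓ ^ (3 : ℕ))) := by gcongr
    _ = (4 * τ * C) * N / ℓ ^ 2 := by field_simp; ring
    _ ≤ (η * ℓ) * N / ℓ ^ 2 := by gcongr
    _ = η * N / ℓ := by field_simp
    _ ≤ η * N := div_le_self (by positivity) hℓ

end RungLevel

/-! ### Registered sub-goal of this helper file -/

/-- **Part 1 of `stub_rungLevelPart` (registered sub-goal `stub_rungLevelPart_part1`).** The Abel
summation bound behind the level piece: for a weight `f` with `0 ≤ f 1`, non-decreasing on
`[1, N]` (`N ≥ 1`), and partial sums of `G` bounded by `M` up to height `N`,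
`|∑_{n ≤ N} f(n) G(n)| ≤ 2 f(N) M`. [folklore] -/
theorem stub_rungLevelPart_part1 :
    ∀ (f G : ℕ → ℝ) (N : ℕ) (M : ℝ), 1 ≤ N → 0 ≤ f 1 → (∀ n : ℕ, 1 ≤ n → n < N → f n ≤ f (n + 1)) → (∀ y : ℕ, y ≤ N → |∑ n ∈ Finset.Icc 1 y, G n| ≤ M) → |∑ n ∈ Finset.Icc 1 N, f n * G n| ≤ 2 * f N * M :=
  fun f G _ M hN hf1 hmono hM => RungLevel.abel_bound f G hN M hf1 hmono hM

end Summit.Parity.GeneralizedHardyLittlewood.Theorems.PairsToGHL.SlopedLadder
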